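import Summits.ResolutionOfSingularities.ResolutionOfSingularities.Theorems.Globalisation.Negative.StubCaSheafCuspCylinder
import Mathlib.LinearAlgebra.Pi
import HarnessLib

/-!
# The matrix factorisation `φ_c, ψ_c` of `y² - x³` over the cusp-cylinder (for `StubCaSheafFalse`)

Negative-lemma chain for crux `Globalisation` (stmt-ResolutionOfSingularities-16486), file 4/6.
`φ_c = [[y + x g, x²], [x - g², y - x g]]`, `ψ_c = adj φ_c`, `g = z - c`:
`φ_c ψ_c = ψ_c φ_c = (y² - x³)·I` over `P = k[z][x][y]`, hence `= 0` over `R`, and the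
matrix-factorisation exactness `ker φ = range ψ`, `ker ψ = range φ` over `R` (lift to `P`,
cancel the non-zero-divisor `f`).
-/

set_option linter.dupNamespace false

-- nested polynomial rings (`k[z][x][y]`) need nested instance synthesis during unification
set_option maxSynthPendingDepth 3

noncomputable section

namespace Summit.ResolutionOfSingularities.ResolutionOfSingularities.Theorems.Globalisation.Negative

open Polynomial

/-! ## The matrix factorisation modules `M_c` over the cusp-cylinder (obstruction side) -/

namespace CuspCylinder

section lin2

variable {A : Type*} [CommRing A]

/-- The linear endomorphism of `A²` with matrix `[[a, b], [c, d]]`. -/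
def lin2 (a b c d : A) : (Fin 2 → A) →ₗ[A] (Fin 2 → A) where
  toFun v := ![a * v 0 + b * v 1, c * v 0 + d * v 1]
  map_add' v w := by
    funext i
    fin_cases i <;> simp <;> ring
  map_smul' t v := by
    funext i
    fin_cases i <;> simp <;> ring

/-- First component of `lin2 a b c d v`. -/
@[simp] theorem lin2_apply_zero (a b c d : A) (v : Fin 2 → A) :
    lin2 a b c d v 0 = a * v 0 + b * v 1 := rfl

/-- Second component of `lin2 a b c d v`. -/
@[simp] theorem lin2_apply_one (a b c d : A) (v : Fin 2 → A) :
    lin2 a b c d v 1 = c * v 0 + d * v 1 := rfl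

end lin2

variable (k : Type) [Field k] (c : k)

/-- Lifts of `x, y, z - c` to `P = k[z][x][y]`. -/
def xP : P k := C X
/-- Lift of `y` to `P`. -/
def yP : P k := X
/-- Lift of `z - c` to `P`. -/
def gP : P k := C (C (X - C c))

/-- `xP` reduces to `x`. -/
@[simp] theorem mk_xP : Ideal.Quotient.mk (RingHom.ker (θ k)) (xP k) = x k := rfl
/-- `yP` reduces to `y`. -/
@[simp] theorem mk_yP : Ideal.Quotient.mk (RingHom.ker (θ k)) (yP k) = y k := rfl
/-- `gP c` reduces to `z - c`. -/
@[simp] theorem mk_gP : Ideal.Quotient.mk (RingHom.ker (θ k)) (gP k c) = zc k c := rfl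

/-- `f = yP² - xP³`. -/
theorem f_eq : f k = yP k ^ 2 - xP k ^ 3 := by
  simp [f, xP, yP, map_pow]

/-- `f ≠ 0`. -/
theorem f_ne_zero : f k ≠ 0 := (f_monic k).ne_zero

/-- The relation `y² = x³` in `R`. -/
theorem y_sq : y k ^ 2 = x k ^ 3 := by
  have h : Ideal.Quotient.mk (RingHom.ker (θ k)) (f k) = 0 :=
    Ideal.Quotient.eq_zero_iff_mem.mpr (by rw [RingHom.mem_ker]; exact θ_f k)
  rw [f_eq, map_sub, map_pow, map_pow, mk_xP, mk_yP, sub_eq_zero] at h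
  exact h

/-- `φ_c = [[y + x g, x²], [x - g², y - x g]]`, `g = z - c`, over `R` … -/
def φ : (Fin 2 → R k) →ₗ[R k] (Fin 2 → R k) :=
  lin2 (y k + x k * zc k c) (x k ^ 2) (x k - zc k c ^ 2) (y k - x k * zc k c)

/-- … and its adjugate `ψ_c = [[y - x g, -x²], [g² - x, y + x g]]`. -/
def ψ : (Fin 2 → R k) →ₗ[R k] (Fin 2 → R k) :=
  lin2 (y k - x k * zc k c) (-(x k ^ 2)) (zc k c ^ 2 - x k) (y k + x k * zc k c)

/-- The same matrices over `P`. -/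
def φP : (Fin 2 → P k) →ₗ[P k] (Fin 2 → P k) :=
  lin2 (yP k + xP k * gP k c) (xP k ^ 2) (xP k - gP k c ^ 2) (yP k - xP k * gP k c)

/-- `ψ_c` over `P`. -/
def ψP : (Fin 2 → P k) →ₗ[P k] (Fin 2 → P k) :=
  lin2 (yP k - xP k * gP k c) (-(xP k ^ 2)) (gP k c ^ 2 - xP k) (yP k + xP k * gP k c)

/-- Componentwise reduction `P² → R²`. -/
def mkv (v : Fin 2 → P k) : Fin 2 → R k := fun i => Ideal.Quotient.mk (RingHom.ker (θ k)) (v i)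

/-- Every vector over `R` lifts to `P`. -/
theorem mkv_surjective : Function.Surjective (mkv k) := by
  intro v
  obtain ⟨a, ha⟩ := Ideal.Quotient.mk_surjective (v 0)
  obtain ⟨b, hb⟩ := Ideal.Quotient.mk_surjective (v 1)
  refine ⟨![a, b], ?_⟩
  funext i
  fin_cases i
  · simpa [mkv] using ha
  · simpa [mkv] using hb

/-- Components of `mkv`. -/
@[simp] theorem mkv_apply (v : Fin 2 → P k) (i : Fin 2) :
    mkv k v i = Ideal.Quotient.mk (RingHom.ker (θ k)) (v i) := rfl

/-- `φ_c` over `P` reduces to `φ_c` over `R`. -/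
theorem mkv_φP (v : Fin 2 → P k) : mkv k (φP k c v) = φ k c (mkv k v) := by
  funext i
  fin_cases i <;> simp [φP, φ, mkv]

/-- `ψ_c` over `P` reduces to `ψ_c` over `R`. -/
theorem mkv_ψP (v : Fin 2 → P k) : mkv k (ψP k c v) = ψ k c (mkv k v) := by
  funext i
  fin_cases i <;> simp [ψP, ψ, mkv]

/-- `ψ_c φ_c = f · I` over `P`. -/
theorem ψP_φP (v : Fin 2 → P k) (i : Fin 2) : ψP k c (φP k c v) i = f k * v i := by
  rw [f_eq]
  fin_cases i <;> simp [ψP, φP] <;> ring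

/-- `φ_c ψ_c = f · I` over `P`. -/
theorem φP_ψP (v : Fin 2 → P k) (i : Fin 2) : φP k c (ψP k c v) i = f k * v i := by
  rw [f_eq]
  fin_cases i <;> simp [ψP, φP] <;> ring

/-- `φ ψ = 0` over `R`. -/
theorem φ_ψ (v : Fin 2 → R k) : φ k c (ψ k c v) = 0 := by
  obtain ⟨w, rfl⟩ := mkv_surjective k v
  rw [← mkv_ψP, ← mkv_φP]
  funext i
  rw [mkv_apply, φP_ψP, map_mul, Pi.zero_apply]
  have h : Ideal.Quotient.mk (RingHom.ker (θ k)) (f k) = 0 :=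
    Ideal.Quotient.eq_zero_iff_mem.mpr (by rw [RingHom.mem_ker]; exact θ_f k)
  rw [h, zero_mul]

/-- `ψ φ = 0` over `R`. -/
theorem ψ_φ (v : Fin 2 → R k) : ψ k c (φ k c v) = 0 := by
  obtain ⟨w, rfl⟩ := mkv_surjective k v
  rw [← mkv_φP, ← mkv_ψP]
  funext i
  rw [mkv_apply, ψP_φP, map_mul, Pi.zero_apply]
  have h : Ideal.Quotient.mk (RingHom.ker (θ k)) (f k) = 0 :=
    Ideal.Quotient.eq_zero_iff_mem.mpr (by rw [RingHom.mem_ker]; exact θ_f k)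
  rw [h, zero_mul]

/-- Matrix-factorisation exactness: `ker φ = range ψ`. -/
theorem ker_φ : LinearMap.ker (φ k c) = LinearMap.range (ψ k c) := by
  apply le_antisymm
  · intro v hv
    rw [LinearMap.mem_ker] at hv
    obtain ⟨w, rfl⟩ := mkv_surjective k v
    rw [← mkv_φP] at hv
    -- each component of `φP w` is a multiple of `f`
    have hcomp : ∀ i, ∃ u, φP k c w i = f k * u := by
      intro i
      have := congrFun hv i
      rw [mkv_apply, Pi.zero_apply, mk_eq_zero_iff] at this
      exact this
    choose u hu using hcomp
    -- `f · w = ψP (φP w) = ψP (f · u) = f · ψP u`, cancel `f`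
    have hw : ∀ i, w i = ψP k c u i := by
      intro i
      have h1 := ψP_φP k c w i
      have h2 : φP k c w = f k • u := by
        funext i'
        rw [hu i', Pi.smul_apply, smul_eq_mul]
      rw [h2, map_smul, Pi.smul_apply, smul_eq_mul] at h1
      exact mul_left_cancel₀ (f_ne_zero k) h1.symm
    refine ⟨mkv k u, ?_⟩
    rw [← mkv_ψP]
    funext i
    simp only [mkv_apply, hw i]
  · rintro _ ⟨w, rfl⟩
    exact φ_ψ k c w

/-- Matrix-factorisation exactness: `ker ψ = range φ`. -/
theorem ker_ψ : LinearMap.ker (ψ k c) = LinearMap.range (φ k c) := by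
  apply le_antisymm
  · intro v hv
    rw [LinearMap.mem_ker] at hv
    obtain ⟨w, rfl⟩ := mkv_surjective k v
    rw [← mkv_ψP] at hv
    have hcomp : ∀ i, ∃ u, ψP k c w i = f k * u := by
      intro i
      have := congrFun hv i
      rw [mkv_apply, Pi.zero_apply, mk_eq_zero_iff] at this
      exact this
    choose u hu using hcomp
    have hw : ∀ i, w i = φP k c u i := by
      intro i
      have h1 := φP_ψP k c w i
      have h2 : ψP k c w = f k • u := by
        funext i'
        rw [hu i', Pi.smul_apply, smul_eq_mul]
      rw [h2, map_smul, Pi.smul_apply, smul_eq_mul] at h1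
      exact mul_left_cancel₀ (f_ne_zero k) h1.symm
    refine ⟨mkv k u, ?_⟩
    rw [← mkv_φP]
    funext i
    simp only [mkv_apply, hw i]
  · rintro _ ⟨w, rfl⟩
    exact ψ_φ k c w

end CuspCylinder

end Summit.ResolutionOfSingularities.ResolutionOfSingularities.Theorems.Globalisation.Negative

end
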